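import Summits.HodgeConjecture.CorCM.MultiFieldWeilPrimeTower
import Summits.HodgeConjecture.CorCM.MultiFieldWeilFrames
import HarnessLib

/-!
# MULTI-FIELD WEIL ENGINE — HEADLINES: ANY NUMBER of CM fields whose relative degrees over `k` are PAIRWISE DISTINCT PRIMES, with ANY types; and one-member
# fields of pairwise coprime relative degrees BELOW such a prime tower — the Hodge conjecture for every product of copies of `E, B_1, …, B_r` GIVEN ONLY the
# single-slot Weil spaces; frame forms and INTRINSIC forms (no frames, no position sets)

Cell `pub-hodgecm2` (COR-CM), seat b30 gen 30 (2026-08-24); count-neutral own lane MULTI-FIELD WEIL ENGINE (stem `MultiFieldWeil*`), sequel of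
`CorCM/MultiFieldWeilPrimeTower.lean` (the defect laws `exists_hasDefectsG_realisedTuples_of_primes` / `…_of_primeTower_oneMember`), `CorCM/MultiFieldWeilHodge.lean`
(the generic headline `hodgeConjectureFor_biproduct_comp_of_defectLawG`) and `CorCM/MultiFieldWeilFrames.lean` (sign frames in every degree).  Theorems only; no
definition, no named fact, no `sorry`.  HONEST FRAMING: each headline is CONDITIONAL on the displayed Weil-space hypotheses `hW m` — ONE abelian variety
`B_m × E^{n_m − 2p_m}` of Weil type per field; in the tree they are discharged by Markman's theorems exactly for `(n_m, p_m) ∈ {(3,1), (4,1), (5,2)}`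
(`CorCM/MultiFieldWeilMarkman.lean`) and `(4,2)` (`CorCM/MultiFieldWeilMarkman22.lean`); every other single-slot Weil space is OPEN.  `HC_CM` is NOT proved and
not asserted.

* §1 **`hodgeConjectureFor_biproduct_comp_of_primes`** (frame form): `E ⊨ (k; {τ})`, `B_m ⊨ (K_m; Φ_m)` over CM fields `K_m ⊇ i_m(k)` whose relative degrees
  `n_m = [K_m : k]` are PAIRWISE DISTINCT PRIMES, each `Φ_m` with `p_m` members over `τ` read at a position set `P_m` (`0 < p_m`, `2 p_m ≤ n_m`; ANY such type — no
  normal form): the Hodge conjecture for EVERY `⨁_j A(κ j)` (all products of copies, any order) GIVEN the Weil spaces of the `B_m ⊞ E^{n_m − 2p_m}`; `…of_avDominatedBy…`.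
  For an odd prime `n_m` a type not induced from `k` is primitive, so each `B_m` is simple of prime dimension and its own powers are classical (Ribet, Tankeev);
  the content here is the products with `E` and with one another, whose Hodge rings acquire exactly the single-slot Weil classes.
* §2 **`hodgeConjectureFor_biproduct_comp_of_primeTower_oneMember`**: a set `L` of ONE-MEMBER slots of pairwise coprime relative degrees, and above it a tower of
  slots of pairwise distinct PRIME relative degrees larger than those of `L`, with any types: same conclusion GIVEN the single-slot Weil spaces.  `L = ∅` is §1;
  an empty tower is gen 29ʼs `hodgeConjectureFor_biproduct_comp_of_coprime_oneMember`; `(3 | 7)` is the census of `SexticTetradecicWeilRealised`; NEW e.g.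
  `E × T × B₄ × B₅ × B₇` with `T` sextic `(1,2)`, `B₄` octic `(1,3)` (the coprime part `3, 4`) and `B₅`, `B₇` over a decic and a tetradecic CM field with ANY types
  (the tower `5 < 7`) — mod Markman `4 + 6` and the Weil spaces of `B₅ × E^{5−2p}` (Markman for `p = 2`) and `B₇ × E^{7−2q}` (open).
* §3 INTRINSIC FORMS **`hodgeConjectureFor_biproduct_comp_of_primes_intrinsic`**, **`…_of_primeTower_oneMember_intrinsic`**: no frames, no position sets — only
  `[K_m : ℚ] = 2 n_m` and the `k`-signatures `p_m = #{s ∈ Φ_m | s ∘ i_m = τ}`; the frames come from `MultiFieldWeil.exists_signFrame` read at the position sets they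
  define (`mem_iff_snd_eq_decide_mem_posSet`, `card_posSet`).
NO hypothesis relating the fields, NO Galois hypothesis.
[cite: Pohlmann1968, Thm 1] [cite: Milne2020HodgeClassesAV, 1.2 (a) and Thm. 1] [cite: MoonenZarhin1995Duke, Thm. 2.4] [cite: DixonMortimer1996, §1.6 and §2.1]
[cite: Ribet1983HodgeClasses, Thm. 0 and §3] [cite: Shimura1998, §18.2 Lemma (i)] [cite: MumfordAV1970, §19]

## References
* [Pohlmann1968] H. Pohlmann, Ann. of Math. 88 (1968), Thm 1.  [Milne2020HodgeClassesAV] J. S. Milne, arXiv:2010.08857, 1.2 (a), Thm. 1.  [MoonenZarhin1995Duke]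
  B. Moonen, Yu. Zarhin, Duke Math. J. 77 (1995), Thm. 2.4.  [DixonMortimer1996] J. D. Dixon, B. Mortimer, *Permutation Groups*, GTM 163, §1.6, §2.1.
  [Ribet1983HodgeClasses] K. A. Ribet, Hodge classes on certain types of abelian varieties, Amer. J. Math. 105 (1983), 523–538, Thm. 0, §3.  [Shimura1998]
  G. Shimura, *Abelian varieties with CM and modular functions*, §18.2 Lemma (i).  [MumfordAV1970] D. Mumford, *Abelian Varieties*, §19.
-/

noncomputable section

open CategoryTheory CategoryTheory.Limits NumberField

namespace Summit.HodgeConjecture.CorCM.MultiFieldWeil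

open Finset
open Literature.AlgebraicGeometry Literature.AlgebraicGeometry.Motives Literature.AlgebraicGeometry.HodgeTheory
open Literature.AlgebraicGeometry.ComplexMultiplication (IsCMTypeRealisation)
open Literature.AlgebraicTopology.SingularHomology
open Literature.NumberTheory.ComplexMultiplication
open Summit.HodgeConjecture.CorCM.Census.MultiFieldWeil

open scoped Classical

variable {I : Type} {r : ℕ} {Kf : I → Type} [∀ i, Field (Kf i)] [∀ i, NumberField (Kf i)] [∀ i, IsCMField (Kf i)]
  {i₀ : I} {is : Fin r → I} {n : Fin r → ℕ} {τ : Kf i₀ →+* ℂ}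
  {A : Fin (r + 1) → AbelianVariety ℂ} {Φ : ∀ j : Fin (r + 1), CMType (Kf (mfSlots i₀ is j))}
  {ι : ∀ j, 𝓞 (Kf (mfSlots i₀ is j)) →+* End (A j)}
  {θ : ∀ j, Kf (mfSlots i₀ is j) →+* Module.End ℂ (complexBetti (A j).X 1)}

/-- `c_m = n_m − 2p_m` as integers when `2p_m ≤ n_m` and `|P m| = p_m`. [folklore] -/
theorem cast_sub_two_mul_eq {P : ∀ m : Fin r, Finset (Fin (n m))} {p : Fin r → ℕ} (hcard : ∀ m, (P m).card = p m) (hpn : ∀ m, 2 * p m ≤ n m)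
    (m : Fin r) : (((n m - 2 * p m : ℕ)) : ℤ) = (n m : ℤ) - 2 * (P m).card := by
  rw [hcard m, Nat.cast_sub (hpn m)]
  push_cast
  ring

/-! ## §1 Pairwise distinct prime relative degrees, any types (frame form) -/

/-- **HEADLINE — ANY NUMBER OF CM FIELDS OF PAIRWISE DISTINCT PRIME RELATIVE DEGREES, ANY TYPES.**  `k = Kf i₀` imaginary quadratic, `E = A 0 ⊨ (k; {τ})`
(`τ(δ) = i√d`), `B_m = A (m+1) ⊨ (K_m; Φ (m+1))` over CM fields `K_m ⊇ i_m(k)` whose relative degrees `n_m = [K_m : k]` are PAIRWISE DISTINCT PRIMES, the type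
`Φ (m+1)` read by the frame `e m` at a position set `P m` of size `p_m` with `0 < p_m`, `2p_m ≤ n_m` (any such type).  Then the Hodge conjecture holds for EVERY
product of copies `⨁_j A(κ j)` — GIVEN, for each `m`, the Weil space of the single-slot part `B_m ⊞ E^{n_m − 2p_m}` (`hW m`).  The defect law is AUTOMATIC (the
prime tower of `CorCM/MultiFieldWeilPrimeTower.lean`, NO hypothesis on the fields); the engine does the rest.  `HC_CM` is NOT asserted; `hW m` is Markman's theorem for
`(n_m, p_m) ∈ {(3,1), (5,2)}` and OPEN otherwise. [cite: Pohlmann1968, Thm 1] [cite: Milne2020HodgeClassesAV, 1.2 (a) and Thm. 1] [cite: MoonenZarhin1995Duke, Thm. 2.4]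
[cite: DixonMortimer1996, §1.6 and §2.1] [cite: Ribet1983HodgeClasses, Thm. 0 and §3] -/
theorem hodgeConjectureFor_biproduct_comp_of_primes (P : ∀ m : Fin r, Finset (Fin (n m))) (p : Fin r → ℕ) (hcard : ∀ m, (P m).card = p m)
    (hpr : ∀ m, (n m).Prime) (hinj : Function.Injective n) (hp0 : ∀ m, 0 < p m) (hpn : ∀ m, 2 * p m ≤ n m)
    {N : ℕ} (κ : Fin N → Fin (r + 1)) (h2 : Module.finrank ℚ (Kf i₀) = 2) (im : ∀ m : Fin r, Kf i₀ →+* Kf (is m))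
    {δ : 𝓞 (Kf i₀)} {d : ℕ} (hτ : τ (δ : Kf i₀) = Complex.I * (Real.sqrt d : ℂ))
    (hA : ∀ j, IsCMTypeRealisation (Φ j) (A j) (ι j) (θ j))
    (e : ∀ m : Fin r, (Kf (is m) →+* ℂ) ≃ Fin (n m) × Bool)
    (he_sign : ∀ (m : Fin r) (s : Kf (is m) →+* ℂ), (e m s).2 = true ↔ s.comp (im m) = τ)
    (he_conj : ∀ (m : Fin r) (s : Kf (is m) →+* ℂ), e m (ComplexEmbedding.conjugate s) = ((e m s).1, !(e m s).2))
    (hΨ : ∀ σ : Kf i₀ →+* ℂ, σ ∈ (Φ 0).1 ↔ σ = τ)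
    (hΦ : ∀ (m : Fin r) (s : Kf (is m) →+* ℂ), s ∈ (Φ m.succ).1 ↔ (e m s).2 = decide ((e m s).1 ∈ P m))
    (hW : ∀ m : Fin r, weilClassesOf (⨁ fun i => A (partSlots (n m - 2 * p m) m i))
      (biproduct.map fun i => ι (partSlots (n m - 2 * p m) m i) (δfam im δ (partSlots (n m - 2 * p m) m i))) (n m - p m) d ≤
      algebraicClasses (⨁ fun i => A (partSlots (n m - 2 * p m) m i)).X (n m - p m)) :
    HodgeConjectureFor (⨁ fun j => A (κ j)).dim (⨁ fun j => A (κ j)).X :=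
  hodgeConjectureFor_biproduct_comp_of_defectLawG (is := is) P (fun m => n m - 2 * p m) (fun m => n m - p m)
    (fun m => by have := hpn m; omega) (fun m => by have := hp0 m; have := hpn m; omega) κ h2 im hτ hA e he_sign he_conj hΨ hΦ
    (fun v T hT => exists_hasDefectsG_realisedTuples_of_primes (e := e) he_sign hpr hinj
      (fun m => Finset.card_pos.1 (by rw [hcard m]; exact hp0 m)) (fun m => by have := hpn m; have := hp0 m; rw [hcard m]; omega)
      (fun m => n m - 2 * p m) (cast_sub_two_mul_eq hcard hpn) v T hT) hW

/-- **… and for every abelian variety DOMINATED by such a product** (isogeny images, abelian subvarieties, quotients). `HC_CM` is NOT asserted.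
[cite: MumfordAV1970, §19] [cite: Pohlmann1968, Thm 1] -/
theorem hodgeConjectureFor_of_avDominatedBy_comp_of_primes (P : ∀ m : Fin r, Finset (Fin (n m))) (p : Fin r → ℕ) (hcard : ∀ m, (P m).card = p m)
    (hpr : ∀ m, (n m).Prime) (hinj : Function.Injective n) (hp0 : ∀ m, 0 < p m) (hpn : ∀ m, 2 * p m ≤ n m)
    {N : ℕ} (κ : Fin N → Fin (r + 1)) (h2 : Module.finrank ℚ (Kf i₀) = 2) (im : ∀ m : Fin r, Kf i₀ →+* Kf (is m))
    {δ : 𝓞 (Kf i₀)} {d : ℕ} (hτ : τ (δ : Kf i₀) = Complex.I * (Real.sqrt d : ℂ))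
    (hA : ∀ j, IsCMTypeRealisation (Φ j) (A j) (ι j) (θ j))
    (e : ∀ m : Fin r, (Kf (is m) →+* ℂ) ≃ Fin (n m) × Bool)
    (he_sign : ∀ (m : Fin r) (s : Kf (is m) →+* ℂ), (e m s).2 = true ↔ s.comp (im m) = τ)
    (he_conj : ∀ (m : Fin r) (s : Kf (is m) →+* ℂ), e m (ComplexEmbedding.conjugate s) = ((e m s).1, !(e m s).2))
    (hΨ : ∀ σ : Kf i₀ →+* ℂ, σ ∈ (Φ 0).1 ↔ σ = τ)
    (hΦ : ∀ (m : Fin r) (s : Kf (is m) →+* ℂ), s ∈ (Φ m.succ).1 ↔ (e m s).2 = decide ((e m s).1 ∈ P m))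
    (hW : ∀ m : Fin r, weilClassesOf (⨁ fun i => A (partSlots (n m - 2 * p m) m i))
      (biproduct.map fun i => ι (partSlots (n m - 2 * p m) m i) (δfam im δ (partSlots (n m - 2 * p m) m i))) (n m - p m) d ≤
      algebraicClasses (⨁ fun i => A (partSlots (n m - 2 * p m) m i)).X (n m - p m))
    {X : AbelianVariety ℂ} (hX : Domination.AVDominatedBy X (⨁ fun j => A (κ j))) : HodgeConjectureFor X.dim X.X :=
  Domination.hodgeConjectureFor_of_avDominatedBy
    (hodgeConjectureFor_biproduct_comp_of_primes P p hcard hpr hinj hp0 hpn κ h2 im hτ hA e he_sign he_conj hΨ hΦ hW) hX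

/-! ## §2 One-member fields of pairwise coprime relative degrees below a prime tower with any types (frame form) -/

/-- **HEADLINE — ONE-MEMBER FIELDS OF PAIRWISE COPRIME RELATIVE DEGREES BELOW A TOWER OF DISTINCT PRIMES WITH ANY TYPES.**  As in §1, with the slots split by a set
`L`: for `m ∈ L` the type has ONE member over `τ` (`p_m = 1`) and the `n_m` (`m ∈ L`) are pairwise coprime; for `m ∉ L` the `n_m` are pairwise distinct
PRIMES, each larger than every `n_{m'}` (`m' ∈ L`), with any type (`0 < p_m`, `2p_m ≤ n_m` throughout).  Then the Hodge conjecture holds for EVERY product of copies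
`⨁_j A(κ j)` GIVEN the single-slot Weil spaces `hW m` (`B_m ⊞ E^{n_m − 2p_m}`).  `L = ∅` is §1; an empty tower is `hodgeConjectureFor_biproduct_comp_of_coprime_oneMember`.
`HC_CM` is NOT asserted. [cite: Pohlmann1968, Thm 1] [cite: Milne2020HodgeClassesAV, 1.2 (a) and Thm. 1] [cite: MoonenZarhin1995Duke, Thm. 2.4]
[cite: DixonMortimer1996, §1.6 and §2.1] -/
theorem hodgeConjectureFor_biproduct_comp_of_primeTower_oneMember (P : ∀ m : Fin r, Finset (Fin (n m))) (p : Fin r → ℕ) (hcard : ∀ m, (P m).card = p m)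
    (L : Finset (Fin r)) (hpr : ∀ m, m ∉ L → (n m).Prime) (hinj : ∀ m m', m ∉ L → m' ∉ L → n m = n m' → m = m')
    (hLt : ∀ m ∈ L, ∀ m', m' ∉ L → n m < n m') (hcop : ∀ m ∈ L, ∀ m' ∈ L, m ≠ m' → (n m).Coprime (n m'))
    (hp1 : ∀ m ∈ L, p m = 1) (hp0 : ∀ m, 0 < p m) (hpn : ∀ m, 2 * p m ≤ n m)
    {N : ℕ} (κ : Fin N → Fin (r + 1)) (h2 : Module.finrank ℚ (Kf i₀) = 2) (im : ∀ m : Fin r, Kf i₀ →+* Kf (is m))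
    {δ : 𝓞 (Kf i₀)} {d : ℕ} (hτ : τ (δ : Kf i₀) = Complex.I * (Real.sqrt d : ℂ))
    (hA : ∀ j, IsCMTypeRealisation (Φ j) (A j) (ι j) (θ j))
    (e : ∀ m : Fin r, (Kf (is m) →+* ℂ) ≃ Fin (n m) × Bool)
    (he_sign : ∀ (m : Fin r) (s : Kf (is m) →+* ℂ), (e m s).2 = true ↔ s.comp (im m) = τ)
    (he_conj : ∀ (m : Fin r) (s : Kf (is m) →+* ℂ), e m (ComplexEmbedding.conjugate s) = ((e m s).1, !(e m s).2))
    (hΨ : ∀ σ : Kf i₀ →+* ℂ, σ ∈ (Φ 0).1 ↔ σ = τ)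
    (hΦ : ∀ (m : Fin r) (s : Kf (is m) →+* ℂ), s ∈ (Φ m.succ).1 ↔ (e m s).2 = decide ((e m s).1 ∈ P m))
    (hW : ∀ m : Fin r, weilClassesOf (⨁ fun i => A (partSlots (n m - 2 * p m) m i))
      (biproduct.map fun i => ι (partSlots (n m - 2 * p m) m i) (δfam im δ (partSlots (n m - 2 * p m) m i))) (n m - p m) d ≤
      algebraicClasses (⨁ fun i => A (partSlots (n m - 2 * p m) m i)).X (n m - p m)) :
    HodgeConjectureFor (⨁ fun j => A (κ j)).dim (⨁ fun j => A (κ j)).X :=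
  hodgeConjectureFor_biproduct_comp_of_defectLawG (is := is) P (fun m => n m - 2 * p m) (fun m => n m - p m)
    (fun m => by have := hpn m; omega) (fun m => by have := hp0 m; have := hpn m; omega) κ h2 im hτ hA e he_sign he_conj hΨ hΦ
    (fun v T hT => exists_hasDefectsG_realisedTuples_of_primeTower_oneMember (e := e) he_sign L hpr hinj hLt hcop
      (fun m hm => Finset.card_eq_one.1 (by rw [hcard m, hp1 m hm]))
      (fun m _ => Finset.card_pos.1 (by rw [hcard m]; exact hp0 m)) (fun m _ => by have := hpn m; have := hp0 m; rw [hcard m]; omega)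
      (fun m => n m - 2 * p m) (cast_sub_two_mul_eq hcard hpn) v T hT) hW

/-- **… and for every abelian variety DOMINATED by such a product.** `HC_CM` is NOT asserted. [cite: MumfordAV1970, §19] [cite: Pohlmann1968, Thm 1] -/
theorem hodgeConjectureFor_of_avDominatedBy_comp_of_primeTower_oneMember (P : ∀ m : Fin r, Finset (Fin (n m))) (p : Fin r → ℕ)
    (hcard : ∀ m, (P m).card = p m)
    (L : Finset (Fin r)) (hpr : ∀ m, m ∉ L → (n m).Prime) (hinj : ∀ m m', m ∉ L → m' ∉ L → n m = n m' → m = m')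
    (hLt : ∀ m ∈ L, ∀ m', m' ∉ L → n m < n m') (hcop : ∀ m ∈ L, ∀ m' ∈ L, m ≠ m' → (n m).Coprime (n m'))
    (hp1 : ∀ m ∈ L, p m = 1) (hp0 : ∀ m, 0 < p m) (hpn : ∀ m, 2 * p m ≤ n m)
    {N : ℕ} (κ : Fin N → Fin (r + 1)) (h2 : Module.finrank ℚ (Kf i₀) = 2) (im : ∀ m : Fin r, Kf i₀ →+* Kf (is m))
    {δ : 𝓞 (Kf i₀)} {d : ℕ} (hτ : τ (δ : Kf i₀) = Complex.I * (Real.sqrt d : ℂ))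
    (hA : ∀ j, IsCMTypeRealisation (Φ j) (A j) (ι j) (θ j))
    (e : ∀ m : Fin r, (Kf (is m) →+* ℂ) ≃ Fin (n m) × Bool)
    (he_sign : ∀ (m : Fin r) (s : Kf (is m) →+* ℂ), (e m s).2 = true ↔ s.comp (im m) = τ)
    (he_conj : ∀ (m : Fin r) (s : Kf (is m) →+* ℂ), e m (ComplexEmbedding.conjugate s) = ((e m s).1, !(e m s).2))
    (hΨ : ∀ σ : Kf i₀ →+* ℂ, σ ∈ (Φ 0).1 ↔ σ = τ)
    (hΦ : ∀ (m : Fin r) (s : Kf (is m) →+* ℂ), s ∈ (Φ m.succ).1 ↔ (e m s).2 = decide ((e m s).1 ∈ P m))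
    (hW : ∀ m : Fin r, weilClassesOf (⨁ fun i => A (partSlots (n m - 2 * p m) m i))
      (biproduct.map fun i => ι (partSlots (n m - 2 * p m) m i) (δfam im δ (partSlots (n m - 2 * p m) m i))) (n m - p m) d ≤
      algebraicClasses (⨁ fun i => A (partSlots (n m - 2 * p m) m i)).X (n m - p m))
    {X : AbelianVariety ℂ} (hX : Domination.AVDominatedBy X (⨁ fun j => A (κ j))) : HodgeConjectureFor X.dim X.X :=
  Domination.hodgeConjectureFor_of_avDominatedBy
    (hodgeConjectureFor_biproduct_comp_of_primeTower_oneMember P p hcard L hpr hinj hLt hcop hp1 hp0 hpn κ h2 im hτ hA e he_sign he_conj hΨ hΦ hW) hX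

/-! ## §3 The intrinsic forms: no frames, no position sets -/

/-- **HEADLINE §1, INTRINSIC FORM (no frames).**  `k = Kf i₀` imaginary quadratic, `E = A 0 ⊨ (k; {τ})`, `B_m = A (m+1) ⊨ (K_m; Φ (m+1))`, `K_m ⊇ i_m(k)` with
`[K_m : ℚ] = 2 n_m`, the `n_m` PAIRWISE DISTINCT PRIMES, and `p_m = #{s ∈ Φ (m+1) | s ∘ i_m = τ}` (the `k`-signature) with `0 < p_m`, `2 p_m ≤ n_m` — i.e. ANY type not
induced from `k` up to the conjugate structure: the Hodge conjecture for EVERY product of copies `⨁_j A(κ j)` GIVEN the single-slot Weil spaces `hW m`.  The frames are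
`MultiFieldWeil.exists_signFrame` read at the position sets they define.  `HC_CM` is NOT asserted. [cite: Pohlmann1968, Thm 1] [cite: Milne2020HodgeClassesAV, 1.2 (a) and Thm. 1]
[cite: MoonenZarhin1995Duke, Thm. 2.4] [cite: Shimura1998, §18.2 Lemma (i)] [cite: Ribet1983HodgeClasses, Thm. 0 and §3] -/
theorem hodgeConjectureFor_biproduct_comp_of_primes_intrinsic (p : Fin r → ℕ)
    (hpr : ∀ m, (n m).Prime) (hinj : Function.Injective n) (hp0 : ∀ m, 0 < p m) (hpn : ∀ m, 2 * p m ≤ n m)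
    {N : ℕ} (κ : Fin N → Fin (r + 1)) (h2 : Module.finrank ℚ (Kf i₀) = 2) (hdeg : ∀ m : Fin r, Module.finrank ℚ (Kf (is m)) = 2 * n m)
    (im : ∀ m : Fin r, Kf i₀ →+* Kf (is m))
    {δ : 𝓞 (Kf i₀)} {d : ℕ} (hτ : τ (δ : Kf i₀) = Complex.I * (Real.sqrt d : ℂ))
    (hA : ∀ j, IsCMTypeRealisation (Φ j) (A j) (ι j) (θ j))
    (hΨ : ∀ σ : Kf i₀ →+* ℂ, σ ∈ (Φ 0).1 ↔ σ = τ)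
    (hp : ∀ m : Fin r, (Finset.univ.filter fun s : Kf (is m) →+* ℂ => s.comp (im m) = τ ∧ s ∈ (Φ m.succ).1).card = p m)
    (hW : ∀ m : Fin r, weilClassesOf (⨁ fun i => A (partSlots (n m - 2 * p m) m i))
      (biproduct.map fun i => ι (partSlots (n m - 2 * p m) m i) (δfam im δ (partSlots (n m - 2 * p m) m i))) (n m - p m) d ≤
      algebraicClasses (⨁ fun i => A (partSlots (n m - 2 * p m) m i)).X (n m - p m)) :
    HodgeConjectureFor (⨁ fun j => A (κ j)).dim (⨁ fun j => A (κ j)).X := by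
  have hττ : ComplexEmbedding.conjugate τ ≠ τ := QuarticCM.conjugate_ne τ
  have hk : ∀ σ : Kf i₀ →+* ℂ, σ = τ ∨ σ = ComplexEmbedding.conjugate τ := fun σ => QuarticCM.eq_or_eq_conjugate_of_quadratic h2 τ σ
  have hfr : ∀ m : Fin r, ∃ e : (Kf (is m) →+* ℂ) ≃ Fin (n m) × Bool, (∀ s, (e s).2 = true ↔ s.comp (im m) = τ) ∧
      ∀ s, e (ComplexEmbedding.conjugate s) = ((e s).1, !(e s).2) := fun m => exists_signFrame (hdeg m) h2 (im m) hττ hk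
  choose e he_sign he_conj using hfr
  exact hodgeConjectureFor_biproduct_comp_of_primes (fun m => Finset.univ.filter fun a : Fin (n m) => (e m).symm (a, true) ∈ (Φ m.succ).1) p
    (fun m => (card_posSet (he_sign m) (Φ m.succ)).trans (hp m)) hpr hinj hp0 hpn κ h2 im hτ hA e he_sign he_conj hΨ
    (fun m s => mem_iff_snd_eq_decide_mem_posSet (he_conj m) (Φ m.succ) s) hW

/-- **HEADLINE §2, INTRINSIC FORM (no frames).**  As `…_of_primes_intrinsic`, with the slots split by `L`: `p_m = 1` and pairwise coprime `n_m` on `L`; pairwise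
distinct prime `n_m`, larger than those of `L`, with any `k`-signature `0 < p_m ≤ n_m / 2` off `L`.  `HC_CM` is NOT asserted. [cite: Pohlmann1968, Thm 1]
[cite: Milne2020HodgeClassesAV, 1.2 (a) and Thm. 1] [cite: MoonenZarhin1995Duke, Thm. 2.4] [cite: Shimura1998, §18.2 Lemma (i)] -/
theorem hodgeConjectureFor_biproduct_comp_of_primeTower_oneMember_intrinsic (p : Fin r → ℕ) (L : Finset (Fin r))
    (hpr : ∀ m, m ∉ L → (n m).Prime) (hinj : ∀ m m', m ∉ L → m' ∉ L → n m = n m' → m = m')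
    (hLt : ∀ m ∈ L, ∀ m', m' ∉ L → n m < n m') (hcop : ∀ m ∈ L, ∀ m' ∈ L, m ≠ m' → (n m).Coprime (n m'))
    (hp1 : ∀ m ∈ L, p m = 1) (hp0 : ∀ m, 0 < p m) (hpn : ∀ m, 2 * p m ≤ n m)
    {N : ℕ} (κ : Fin N → Fin (r + 1)) (h2 : Module.finrank ℚ (Kf i₀) = 2) (hdeg : ∀ m : Fin r, Module.finrank ℚ (Kf (is m)) = 2 * n m)
    (im : ∀ m : Fin r, Kf i₀ →+* Kf (is m))
    {δ : 𝓞 (Kf i₀)} {d : ℕ} (hτ : τ (δ : Kf i₀) = Complex.I * (Real.sqrt d : ℂ))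
    (hA : ∀ j, IsCMTypeRealisation (Φ j) (A j) (ι j) (θ j))
    (hΨ : ∀ σ : Kf i₀ →+* ℂ, σ ∈ (Φ 0).1 ↔ σ = τ)
    (hp : ∀ m : Fin r, (Finset.univ.filter fun s : Kf (is m) →+* ℂ => s.comp (im m) = τ ∧ s ∈ (Φ m.succ).1).card = p m)
    (hW : ∀ m : Fin r, weilClassesOf (⨁ fun i => A (partSlots (n m - 2 * p m) m i))
      (biproduct.map fun i => ι (partSlots (n m - 2 * p m) m i) (δfam im δ (partSlots (n m - 2 * p m) m i))) (n m - p m) d ≤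
      algebraicClasses (⨁ fun i => A (partSlots (n m - 2 * p m) m i)).X (n m - p m)) :
    HodgeConjectureFor (⨁ fun j => A (κ j)).dim (⨁ fun j => A (κ j)).X := by
  have hττ : ComplexEmbedding.conjugate τ ≠ τ := QuarticCM.conjugate_ne τ
  have hk : ∀ σ : Kf i₀ →+* ℂ, σ = τ ∨ σ = ComplexEmbedding.conjugate τ := fun σ => QuarticCM.eq_or_eq_conjugate_of_quadratic h2 τ σ
  have hfr : ∀ m : Fin r, ∃ e : (Kf (is m) →+* ℂ) ≃ Fin (n m) × Bool, (∀ s, (e s).2 = true ↔ s.comp (im m) = τ) ∧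
      ∀ s, e (ComplexEmbedding.conjugate s) = ((e s).1, !(e s).2) := fun m => exists_signFrame (hdeg m) h2 (im m) hττ hk
  choose e he_sign he_conj using hfr
  exact hodgeConjectureFor_biproduct_comp_of_primeTower_oneMember (fun m => Finset.univ.filter fun a : Fin (n m) => (e m).symm (a, true) ∈ (Φ m.succ).1) p
    (fun m => (card_posSet (he_sign m) (Φ m.succ)).trans (hp m)) L hpr hinj hLt hcop hp1 hp0 hpn κ h2 im hτ hA e he_sign he_conj hΨ
    (fun m s => mem_iff_snd_eq_decide_mem_posSet (he_conj m) (Φ m.succ) s) hW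

end Summit.HodgeConjecture.CorCM.MultiFieldWeil

end
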